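import Summits.QuantumFields.GaugeBoot.DiagonalRPTorusLonelyLink
import Summits.QuantumFields.GaugeBoot.DiagonalRPTorusFins
import HarnessLib

/-!
# Cluster terms of two columns at distance two: the band dominates (gauge-boot, task L3(π), 4/7)

HONEST FRAMING (cell `pub-gaugeboot`, page 1 of every file): the venture produces certified bounds
on lattice expectations at stated coupling, gauge group, dimension and torus size; NOT a mass gap,
NOT a continuum limit, NOT a string tension; NOT Yang–Mills-summit-bearing (barriers
`FixedCouplingUltralocality`, `PerturbativeInvisibility`). This module is analytic bookkeeping for
the structural NEGATIVE result `DiagonalRPTorusInnerHalfNegativeEvenSUN` (inner-half diagonal RP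
fails on even three-tori for `G ≅ SU(N)` at small coupling); it discharges nothing by itself.

## Content (torus `(ℤ/L)³`, any compact metrisable `G`, continuous `ρ` with a centre element
`ρ z₀ = ω • 1`, `ω ≠ 1`; `0 ≤ β`, `γ = 2βN ≤ 1`)

For the pair terms `T_S(A,B)` of `DiagonalRPTorusClusterTerms`:
* `abs_pairTerm_sub_pow_mul_le` — `|T_S(A,B) - β^{|S|} ∫ P_A P_B ∏_{p∈S} Re tr ρ(U_p)| ≤
  N² 2^{|S|} (βN)^{|S|+1}` (second-order Taylor remainder per plaquette, every `S`);
* `pairTerm_eq_zero_of_card_lt` — distinct non-adjacent columns: `T_S = 0` for `|S| < 2L`;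
* **`abs_pairTerm_le_of_sep`** — SEPARATED columns (`DiagRPSUN.Sep`, no common neighbour):
  `|T_S(A,B)| ≤ N² γ^{2L+1}` for EVERY `S` (`L ≥ 2`): below order `2L+1` a non-zero term would be
  a minimal cover, which has a lonely link (`DiagRPSUN.exists_lonely_of_sep`) and is killed by
  the lonely-link reduction (`DiagRPSUN.pairTerm_eq_zero_of_lonely`);
* **`abs_pairTerm_le_of_ne_band`** — the pair `(B + 2e_a, B)` (`L ≥ 5`): the same bound for every
  `S ≠ band B pl`;
* `bandIntegral ρ pl B = ∫ P_{B+2e_a} P_B ∏_z Re tr ρ(U_{p_z}) Re tr ρ(U_{p'_z})` over the `2L`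
  band plaquettes and **`abs_pairTerm_band_sub_le`** —
  `|T_{band}(B + 2e_a, B) - β^{2L} bandIntegral| ≤ N² 2^{2L} (βN)^{2L+1}`.

Elementary; no named fact.
-/

open MeasureTheory Complex Finset Function
open scoped ComplexOrder

namespace Summit.QuantumFields.GaugeBoot

open Literature.MathematicalPhysics.QuantumFieldTheory
open Literature.MathematicalPhysics.QuantumFieldTheory.PlaquetteLowerBound (reTr)
open Literature.RepresentationTheory.CompactGroups

noncomputable section

namespace DiagRPSUN

open DiagRPThree DiagRPPolyakov

section Pair

variable {L : ℕ} [NeZero L] {N : ℕ} {G : Type*} [Group G] [TopologicalSpace G]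
  [IsTopologicalGroup G] [CompactSpace G] [MeasurableSpace G] [BorelSpace G]
  [SecondCountableTopology G] (ρ : G →* Matrix (Fin N) (Fin N) ℂ) (β : ℝ)

/-! ## The leading order of a pair term -/

/-- **Leading order of a pair term**: `|T_S(A,B) - β^{|S|} ∫ P_A P_B ∏_{p ∈ S} Re tr ρ(U_p)| ≤
N² 2^{|S|} (βN)^{|S|+1}` for `0 ≤ β`, `βN ≤ 1`. -/
theorem abs_pairTerm_sub_pow_mul_le (hρ : Continuous ρ) (hβ : 0 ≤ β) (hβN : β * N ≤ 1)
    (S : Finset (Plaquette 3 L)) (A B : ZMod L × ZMod L) :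
    |pairTerm ρ β S A B - β ^ S.card * ∫ U, polRe ρ 2 U (vsite A 0) * polRe ρ 2 U (vsite B 0) *
        ∏ p ∈ S, WilsonRP.plaqRe ρ U p ∂Measure.pi fun _ : Edge 3 L => haarProbability G| ≤
      N ^ 2 * (2 ^ S.card * (β * N) ^ (S.card + 1)) := by
  have hpow : ∀ U : GaugeConfig 3 L G, β ^ S.card * ∏ p ∈ S, WilsonRP.plaqRe ρ U p =
      ∏ p ∈ S, β * WilsonRP.plaqRe ρ U p := fun U => by
    rw [prod_mul_distrib, prod_const]
  have hcont : Continuous fun U : GaugeConfig 3 L G =>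
      polRe ρ 2 U (vsite A 0) * polRe ρ 2 U (vsite B 0) * ∏ p ∈ S, WilsonRP.plaqRe ρ U p :=
    ((continuous_polRe ρ hρ 2 _).mul (continuous_polRe ρ hρ 2 _)).mul
      (continuous_finsetProd _ fun p _ => continuous_plaqRe ρ hρ _)
  have hI2 : Integrable (fun U : GaugeConfig 3 L G => β ^ S.card *
      (polRe ρ 2 U (vsite A 0) * polRe ρ 2 U (vsite B 0) * ∏ p ∈ S, WilsonRP.plaqRe ρ U p))
      (Measure.pi fun _ : Edge 3 L => haarProbability G) :=
    (integrable_of_continuous_config hcont).const_mul _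
  unfold pairTerm
  rw [← integral_const_mul, ← integral_sub (integrable_of_continuous_config
      (continuous_pairIntegrand ρ β hρ _ _ _)) hI2]
  have hbd : ∀ U : GaugeConfig 3 L G,
      ‖polRe ρ 2 U (vsite A 0) * polRe ρ 2 U (vsite B 0) * ∏ p ∈ S, gfac ρ β p U -
        β ^ S.card * (polRe ρ 2 U (vsite A 0) * polRe ρ 2 U (vsite B 0) *
          ∏ p ∈ S, WilsonRP.plaqRe ρ U p)‖ ≤ N ^ 2 * (2 ^ S.card * (β * N) ^ (S.card + 1)) := by
    intro U
    have hfold : β ^ S.card * (polRe ρ 2 U (vsite A 0) * polRe ρ 2 U (vsite B 0) *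
        ∏ p ∈ S, WilsonRP.plaqRe ρ U p) = polRe ρ 2 U (vsite A 0) * polRe ρ 2 U (vsite B 0) *
          ∏ p ∈ S, β * WilsonRP.plaqRe ρ U p := by
      rw [← hpow]; ring
    rw [hfold, ← mul_sub, Real.norm_eq_abs, abs_mul, abs_mul]
    have hP := abs_polRe_le ρ hρ (2 : Fin 3) U (vsite A 0)
    have hQ := abs_polRe_le ρ hρ (2 : Fin 3) U (vsite B 0)
    have hdiff := abs_prod_add_sub_prod_le S (fun p => β * WilsonRP.plaqRe ρ U p)
      (fun p => gfac ρ β p U - β * WilsonRP.plaqRe ρ U p) (t := β * N) (by positivity) hβN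
      (fun p _ => by
        rw [abs_mul, abs_of_nonneg hβ]
        exact mul_le_mul_of_nonneg_left (WilsonRP.abs_plaqRe_le ρ hρ U _) hβ)
      (fun p _ => abs_gfac_sub_le ρ β hρ hβ hβN _ U)
    simp only [add_sub_cancel] at hdiff
    calc |polRe ρ 2 U (vsite A 0)| * |polRe ρ 2 U (vsite B 0)| *
          |∏ p ∈ S, gfac ρ β p U - ∏ p ∈ S, β * WilsonRP.plaqRe ρ U p|
        ≤ N * N * (2 ^ S.card * (β * N) ^ (S.card + 1)) :=
          mul_le_mul (mul_le_mul hP hQ (abs_nonneg _) (Nat.cast_nonneg _)) hdiff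
            (abs_nonneg _) (by positivity)
      _ = N ^ 2 * (2 ^ S.card * (β * N) ^ (S.card + 1)) := by ring
  have h := norm_integral_le_of_norm_le_const
    (μ := Measure.pi fun _ : Edge 3 L => haarProbability G) (ae_of_all _ hbd)
  rwa [probReal_univ, mul_one, Real.norm_eq_abs] at h

/-! ## Below order `2L + 1` -/

/-- **Non-adjacent columns below order `2L`**: `T_S(A,B) = 0` for `|S| < 2L` (one column is not
covered; centre twist). -/
theorem pairTerm_eq_zero_of_card_lt (hρ : Continuous ρ) {z₀ : G} {ω : ℂ}
    (hz₀ : ρ z₀ = ω • (1 : Matrix (Fin N) (Fin N) ℂ)) (hω : ω ≠ 1) {A B : ZMod L × ZMod L}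
    (hAB : A ≠ B) (hn : ¬ Adj A B) {S : Finset (Plaquette 3 L)} (hcard : S.card < 2 * L) :
    pairTerm ρ β S A B = 0 := by
  by_cases hA : Covers S A
  · by_cases hB : Covers S B
    · have := two_mul_le_card_of_covers_of_not_adj hAB hn hA hB
      omega
    · exact pairTerm_eq_zero_of_not_covers_right ρ β hρ hz₀ hω hAB hB
  · exact pairTerm_eq_zero_of_not_covers_left ρ β hρ hz₀ hω hAB hA

/-- **Separated columns up to order `2L`**: `T_S(A,B) = 0` for `|S| ≤ 2L` (a minimal cover has a
lonely link, and removing its plaquette uncovers a column). -/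
theorem pairTerm_eq_zero_of_sep (hρ : Continuous ρ) {z₀ : G} {ω : ℂ}
    (hz₀ : ρ z₀ = ω • (1 : Matrix (Fin N) (Fin N) ℂ)) (hω : ω ≠ 1) (hL : 1 < L)
    {A B : ZMod L × ZMod L} (hsep : Sep A B) {S : Finset (Plaquette 3 L)}
    (hcard : S.card ≤ 2 * L) : pairTerm ρ β S A B = 0 := by
  have hAB := ne_of_sep hsep
  have hn := not_adj_of_sep hsep
  by_cases hA : Covers S A
  · by_cases hB : Covers S B
    · obtain ⟨p, hp, ℓ, hℓ, hAℓ, hBℓ, hlone⟩ := exists_lonely_of_sep hL hsep hA hB hcard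
      refine pairTerm_eq_zero_of_lonely ρ β hρ hL hp hℓ hlone hAℓ hBℓ ?_
      exact pairTerm_eq_zero_of_card_lt ρ β hρ hz₀ hω hAB hn
        (by rw [card_erase_of_mem hp]; have := card_pos.2 ⟨p, hp⟩; omega)
    · exact pairTerm_eq_zero_of_not_covers_right ρ β hρ hz₀ hω hAB hB
  · exact pairTerm_eq_zero_of_not_covers_left ρ β hρ hz₀ hω hAB hA

/-- **Separated columns**: `|T_S(A,B)| ≤ N² γ^{2L+1}` for EVERY `S`, `γ = 2βN ≤ 1`, `L ≥ 2`. -/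
theorem abs_pairTerm_le_of_sep (hρ : Continuous ρ) {z₀ : G} {ω : ℂ}
    (hz₀ : ρ z₀ = ω • (1 : Matrix (Fin N) (Fin N) ℂ)) (hω : ω ≠ 1) (hβ : 0 ≤ β)
    (hγ : 2 * β * N ≤ 1) (hL : 1 < L) {A B : ZMod L × ZMod L} (hsep : Sep A B)
    (S : Finset (Plaquette 3 L)) : |pairTerm ρ β S A B| ≤ N ^ 2 * (2 * β * N) ^ (2 * L + 1) := by
  have hβN : β * N ≤ 1 := by nlinarith [mul_nonneg hβ (Nat.cast_nonneg N : (0 : ℝ) ≤ N)]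
  by_cases hcard : S.card ≤ 2 * L
  · rw [pairTerm_eq_zero_of_sep ρ β hρ hz₀ hω hL hsep hcard, abs_zero]
    positivity
  · refine (abs_pairTerm_le ρ β hρ hβ hβN S A B).trans ?_
    exact mul_le_mul_of_nonneg_left (pow_le_pow_of_le_one (by positivity) hγ (by omega))
      (by positivity)

/-- **The pair `(B + 2e_a, B)` up to order `2L`**: `T_S = 0` for every `S ≠ band B pl` with
`|S| ≤ 2L` (`L ≥ 5`). -/
theorem pairTerm_eq_zero_of_ne_band (hρ : Continuous ρ) {z₀ : G} {ω : ℂ}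
    (hz₀ : ρ z₀ = ω • (1 : Matrix (Fin N) (Fin N) ℂ)) (hω : ω ≠ 1) (hL : 5 ≤ L)
    (pl : {q : Fin 3 × Fin 3 // q.1 < q.2}) (hpl : pl.1.2 = 2) (B : ZMod L × ZMod L)
    {S : Finset (Plaquette 3 L)} (hcard : S.card ≤ 2 * L) (hS : S ≠ band B pl) :
    pairTerm ρ β S (bump pl.1.1 (bump pl.1.1 B)) B = 0 := by
  have hL1 : 1 < L := by omega
  have ha := fst_ne_two pl hpl
  have hAB : bump pl.1.1 (bump pl.1.1 B) ≠ B := bump_bump_ne_self (by omega) ha B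
  have hn : ¬ Adj (bump pl.1.1 (bump pl.1.1 B)) B := not_adj_bump_bump hL ha B
  by_cases hA : Covers S (bump pl.1.1 (bump pl.1.1 B))
  · by_cases hB : Covers S B
    · obtain ⟨p, hp, ℓ, hℓ, hAℓ, hBℓ, hlone⟩ :=
        exists_lonely_of_ne_band hL pl hpl B hA hB hcard hS
      refine pairTerm_eq_zero_of_lonely ρ β hρ hL1 hp hℓ hlone hAℓ hBℓ ?_
      exact pairTerm_eq_zero_of_card_lt ρ β hρ hz₀ hω hAB hn
        (by rw [card_erase_of_mem hp]; have := card_pos.2 ⟨p, hp⟩; omega)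
    · exact pairTerm_eq_zero_of_not_covers_right ρ β hρ hz₀ hω hAB hB
  · exact pairTerm_eq_zero_of_not_covers_left ρ β hρ hz₀ hω hAB hA

/-- **The pair `(B + 2e_a, B)`, not the band**: `|T_S| ≤ N² γ^{2L+1}` for every `S ≠ band B pl`
(`L ≥ 5`). -/
theorem abs_pairTerm_le_of_ne_band (hρ : Continuous ρ) {z₀ : G} {ω : ℂ}
    (hz₀ : ρ z₀ = ω • (1 : Matrix (Fin N) (Fin N) ℂ)) (hω : ω ≠ 1) (hβ : 0 ≤ β)
    (hγ : 2 * β * N ≤ 1) (hL : 5 ≤ L) (pl : {q : Fin 3 × Fin 3 // q.1 < q.2}) (hpl : pl.1.2 = 2)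
    (B : ZMod L × ZMod L) {S : Finset (Plaquette 3 L)} (hS : S ≠ band B pl) :
    |pairTerm ρ β S (bump pl.1.1 (bump pl.1.1 B)) B| ≤ N ^ 2 * (2 * β * N) ^ (2 * L + 1) := by
  have hβN : β * N ≤ 1 := by nlinarith [mul_nonneg hβ (Nat.cast_nonneg N : (0 : ℝ) ≤ N)]
  by_cases hcard : S.card ≤ 2 * L
  · rw [pairTerm_eq_zero_of_ne_band ρ β hρ hz₀ hω hL pl hpl B hcard hS, abs_zero]
    positivity
  · refine (abs_pairTerm_le ρ β hρ hβ hβN S _ B).trans ?_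
    exact mul_le_mul_of_nonneg_left (pow_le_pow_of_le_one (by positivity) hγ (by omega))
      (by positivity)

/-! ## The band term -/

/-- The BAND INTEGRAL `∫ P_{B+2e_a} P_B ∏_z Re tr ρ(U_{(vsite (B+e_a) z, pl)}) Re tr ρ(U_{(vsite B z, pl)}) ∏ dU`:
the leading coefficient of the band term. -/
def bandIntegral (pl : {q : Fin 3 × Fin 3 // q.1 < q.2}) (B : ZMod L × ZMod L) : ℝ :=
  ∫ U, polRe ρ 2 U (vsite (bump pl.1.1 (bump pl.1.1 B)) 0) * polRe ρ 2 U (vsite B 0) *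
    ∏ z : ZMod L, (WilsonRP.plaqRe ρ U (vsite (bump pl.1.1 B) z, pl) *
      WilsonRP.plaqRe ρ U (vsite B z, pl)) ∂Measure.pi fun _ : Edge 3 L => haarProbability G

omit [TopologicalSpace G] [IsTopologicalGroup G] [CompactSpace G] [MeasurableSpace G] [BorelSpace G]
  [SecondCountableTopology G] in
/-- The product over the band splits into the two ladders. -/
theorem prod_band (hL : 1 < L) (pl : {q : Fin 3 × Fin 3 // q.1 < q.2}) (hpl : pl.1.2 = 2)
    (B : ZMod L × ZMod L) (f : Plaquette 3 L → ℝ) :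
    ∏ p ∈ band B pl, f p = ∏ z : ZMod L, (f (vsite (bump pl.1.1 B) z, pl) * f (vsite B z, pl)) := by
  have hinj : ∀ C : ZMod L × ZMod L, Function.Injective fun z : ZMod L => ((vsite C z, pl) : Plaquette 3 L) :=
    fun C z w h => (vsite_eq_vsite_iff.1 (congrArg Prod.fst h)).2
  unfold band
  rw [prod_union (disjoint_ladders hL B pl hpl), prod_mul_distrib, mul_comm]
  unfold ladder
  rw [prod_image fun z _ w _ h => hinj _ h, prod_image fun z _ w _ h => hinj _ h]

/-- **The band term to leading order**:
`|T_{band}(B + 2e_a, B) - β^{2L} bandIntegral| ≤ N² 2^{2L} (βN)^{2L+1}` (`L ≥ 2`). -/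
theorem abs_pairTerm_band_sub_le (hρ : Continuous ρ) (hβ : 0 ≤ β) (hβN : β * N ≤ 1) (hL : 1 < L)
    (pl : {q : Fin 3 × Fin 3 // q.1 < q.2}) (hpl : pl.1.2 = 2) (B : ZMod L × ZMod L) :
    |pairTerm ρ β (band B pl) (bump pl.1.1 (bump pl.1.1 B)) B - β ^ (2 * L) * bandIntegral ρ pl B| ≤
      N ^ 2 * (2 ^ (2 * L) * (β * N) ^ (2 * L + 1)) := by
  have h := abs_pairTerm_sub_pow_mul_le ρ β hρ hβ hβN (band B pl) (bump pl.1.1 (bump pl.1.1 B)) B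
  rw [card_band hL B pl hpl] at h
  have hI : (∫ U, polRe ρ 2 U (vsite (bump pl.1.1 (bump pl.1.1 B)) 0) * polRe ρ 2 U (vsite B 0) *
      ∏ p ∈ band B pl, WilsonRP.plaqRe ρ U p ∂Measure.pi fun _ : Edge 3 L => haarProbability G) =
      bandIntegral ρ pl B := by
    unfold bandIntegral
    exact integral_congr_ae (ae_of_all _ fun U => by simp only [prod_band hL pl hpl B])
  rwa [hI] at h

end Pair

end DiagRPSUN

end

end Summit.QuantumFields.GaugeBoot
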